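import Summits.CriticalPhenomena.PercolationContinuityZ3.Theorems.PercNearOneGluingNoHeavyLowerTailStarSetPoolDemand
import Summits.CriticalPhenomena.PercolationContinuityZ3.Theorems.PercNearOneGluingNoHeavyLowerTailStarSetPoolDemandGroups
import Summits.CriticalPhenomena.PercolationContinuityZ3.Theorems.PercNearOneGluingNoHeavyLowerTailStarSetPoolScaled
import HarnessLib

/-!
# `NoHeavyLowerTail` (stmt-CriticalPhenomena-4575) — the POOL of the U1′_r charging scheme (U1-PROOF.md §7; blueprint §F6/§G4)

Support file (prover `prim-gen-swap` gen 15; `--supports stmt-CriticalPhenomena-4575`).  No definitions, no named facts, no sorries.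

`StarSet.pool_bound`: the CORE configurations of the residual `𝓤_dom` pairs are paid by the pool credit `E₀ = Σ_{R ⊆ Pool} W(R)
= Π_{V ∉ Pool}(1 − θ_V)` plus the pool words.  Abstract form (classes `ι`, weights `θ < 1`, `t = θ/(1−θ)`, `T = t_{I₀}`):
* partner groups `J ∈ Js` with hubs `𝒳 J` (hubs `≠ I₀` when flagged), a symmetric "triangle matching" `M J` (each hub matched to at
  most one other), a dominator
  `Dg J X` with `θ_X ≤ θ_{Dg J X}`, and a flag `fl J X` (the leaf class `I₀` may ride): units `(S, X)` with `S ⊇ {X, J}`,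
  `S ∖ {X, J} ⊆ Pool (∪ {I₀} if flagged)`; words: SELF of value `≥ t_X t_J t_{Dg} (+ t_X t_J T if flagged and Dg ≠ I₀)` and, for every
  ORDERED unmatched pair `(X, Y)` of hubs, a CROSS word of value `≥ t_X t_Y t_J`;
* the `I₀`-group: cold hubs `Hc` (units `S ⊇ {X, I₀}`, `S ∖ {X, I₀} ⊆ Pool`; SELF `≥ T t_X²`) and hot hubs `Hh` with dominators `Dh X`
  (bundle units: `X ∈ S`, `S ∖ {X} ⊆ Pool ∪ {I₀, Dh X}`, `S` meets `{I₀, Dh X}`; SELF `≥ T t_X t_{Dh X}`), at most two hot hubs per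
  dominator, `θ_X ≤ θ_{I₀}, θ_{Dh X}`; CROSS words `≥ T t_X t_Y` for unordered pairs of `I₀`-hubs.
Then `Σ_units W ≤ E₀ + Σ words` — by the cylinder sums (demand of an entry in pool units), the per-entry NEED inequalities and
`pool_scaled_total_le_one` ((P∅) with `P = 1/E₀ = Π_{V ∉ Pool}(1 + t_V)`).
-/

namespace Summit.CriticalPhenomena.PercolationContinuityZ3.Theorems

open Finset
open scoped BigOperators

namespace StarSet

variable {ι : Type*} [Fintype ι] [LinearOrder ι]

/-- NEED of a partner-group entry: demand `E a b (1 + flT)` minus self word (`≥ (1−E) a² b + E a b flT`) minus cross words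
(`≥ a σ b`) is at most `E · b · a (1 − (P−1)(a + σ))` when `E (P − 1) = 1 − E`. [U1-PROOF.md L7.2] -/
theorem pool_need_group (E P a b σ flT ws wc : ℝ) (hE0 : 0 ≤ E) (hEP : E * (P - 1) = 1 - E)
    (ha : 0 ≤ a) (hb : 0 ≤ b) (hσ : 0 ≤ σ) (hws : (1 - E) * (a * a * b) + E * (a * b * flT) ≤ ws) (hwc : a * σ * b ≤ wc) :
    E * (a * b * (1 + flT)) - (ws + wc) ≤ E * (b * (a * (1 - (P - 1) * (a + σ)))) := by
  have h : E * (b * (a * (1 - (P - 1) * (a + σ)))) = E * a * b - (E * (P - 1)) * (a * b * (a + σ)) := by ring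
  rw [h, hEP]
  have : 0 ≤ E * a * b * σ := by positivity
  nlinarith

/-- NEED of a cold hub of the I₀-group. [U1-PROOF.md L7.3(i)] -/
theorem pool_need_cold (E P a T s ws wch : ℝ) (hEP : E * P = 1) (hws : T * a * a ≤ ws) (hwc : T * a * (s - a) ≤ 2 * wch) :
    E * (T * a) - (ws + wch) ≤ E * (T * (a * (1 - P * a - P * (s - a) / 2))) := by
  have h : E * (T * (a * (1 - P * a - P * (s - a) / 2))) = E * T * a - (E * P) * (T * a * a) - (E * P) * (T * a * (s - a)) / 2 := by
    ring
  rw [h, hEP]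
  linarith

/-- NEED of an I-hot bundle of the I₀-group. [U1-PROOF.md L7.3(ii)] -/
theorem pool_need_hot (E P a d T s ws wch : ℝ) (hEP : E * P = 1) (hws : T * a * d ≤ ws) (hwc : T * a * (s - a) ≤ 2 * wch) :
    E * (a * (T + d + T * d)) - (ws + wch) ≤ E * (a * (T + d + T * d - P * T * d - P * T * (s - a) / 2)) := by
  have h : E * (a * (T + d + T * d - P * T * d - P * T * (s - a) / 2)) =
      E * (a * (T + d + T * d)) - (E * P) * (T * a * d) - (E * P) * (T * a * (s - a)) / 2 := by ring
  rw [h, hEP]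
  linarith

/-- `max 0 x ≤ c · max 0 y` when `x ≤ c y`, `c ≥ 0`. -/
theorem max_zero_le_mul_max_zero (x c y : ℝ) (hc : 0 ≤ c) (h : x ≤ c * y) : max 0 x ≤ c * max 0 y := by
  rcases le_or_gt y 0 with hy | hy
  · have : c * y ≤ 0 := mul_nonpos_of_nonneg_of_nonpos hc hy
    rw [max_eq_left (by linarith)]
    exact mul_nonneg hc (le_max_left _ _)
  · rw [max_eq_right hy.le]
    exact max_le (by positivity) h

/-- **The pool bound (U1-PROOF.md §7, L7.2–L7.3).**  See the file header. -/
theorem pool_bound (θ : ι → ℝ) (hθ0 : ∀ k, 0 ≤ θ k) (hθ1 : ∀ k, θ k < 1) (Pool : Finset ι) (I₀ : ι) (hI₀ : I₀ ∉ Pool)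
    -- partner groups `J ≠ I₀`
    (Js : Finset ι) (hJs : ∀ J ∈ Js, J ∉ Pool ∧ J ≠ I₀)
    (fl : ι → ι → Prop) [∀ J, DecidablePred (fl J)]
    (𝒳 : ι → Finset ι) (h𝒳 : ∀ J ∈ Js, ∀ X ∈ 𝒳 J, X ∉ Pool ∧ X ≠ J ∧ (fl J X → X ≠ I₀))
    (M : ι → ι → ι → Prop) [∀ J, DecidableRel (M J)]
    (hMsymm : ∀ J ∈ Js, ∀ X ∈ 𝒳 J, ∀ Y ∈ 𝒳 J, M J X Y → M J Y X)
    (hMuniq : ∀ J ∈ Js, ∀ X ∈ 𝒳 J, ({Y ∈ 𝒳 J | Y ≠ X ∧ M J X Y} : Finset ι).card ≤ 1)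
    (Dg : ι → ι → ι) (hDg : ∀ J ∈ Js, ∀ X ∈ 𝒳 J, θ X ≤ θ (Dg J X))
    (wself : ι → ι → ℝ)
    (hwself : ∀ J ∈ Js, ∀ X ∈ 𝒳 J,
      θ X / (1 - θ X) * (θ J / (1 - θ J)) * (θ (Dg J X) / (1 - θ (Dg J X))) +
        (if fl J X ∧ Dg J X ≠ I₀ then θ X / (1 - θ X) * (θ J / (1 - θ J)) * (θ I₀ / (1 - θ I₀)) else 0) ≤ wself J X)
    (wcross : ι → ι → ι → ℝ)
    (hwcross : ∀ J ∈ Js, ∀ X ∈ 𝒳 J, ∀ Y ∈ 𝒳 J, Y ≠ X → ¬ M J X Y →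
      θ X / (1 - θ X) * (θ Y / (1 - θ Y)) * (θ J / (1 - θ J)) ≤ wcross J X Y)
    -- the `I₀`-group
    (Hc Hh : Finset ι) (hHcHh : Disjoint Hc Hh) (hHc : ∀ X ∈ Hc, X ∉ Pool ∧ X ≠ I₀) (hHh : ∀ X ∈ Hh, X ∉ Pool ∧ X ≠ I₀)
    (Dh : ι → ι) (hDh : ∀ X ∈ Hh, Dh X ∉ Pool ∧ Dh X ≠ I₀ ∧ Dh X ∉ Hh ∧ Dh X ≠ X ∧ θ X ≤ θ (Dh X) ∧ θ X ≤ θ I₀)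
    (hfib : ∀ δ ∈ Hh.image Dh, ({X ∈ Hh | Dh X = δ} : Finset ι).card ≤ 2)
    (wselfI : ι → ℝ)
    (hwselfIc : ∀ X ∈ Hc, θ I₀ / (1 - θ I₀) * (θ X / (1 - θ X)) * (θ X / (1 - θ X)) ≤ wselfI X)
    (hwselfIh : ∀ X ∈ Hh, θ I₀ / (1 - θ I₀) * (θ X / (1 - θ X)) * (θ (Dh X) / (1 - θ (Dh X))) ≤ wselfI X)
    (wcrossI : ι → ι → ℝ)
    (hwcrossI : ∀ X ∈ Hc ∪ Hh, ∀ Y ∈ Hc ∪ Hh, X < Y →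
      θ I₀ / (1 - θ I₀) * (θ X / (1 - θ X)) * (θ Y / (1 - θ Y)) ≤ wcrossI X Y)
    -- the core units
    (Ug Uc Uh : Finset (Finset ι × ι)) (Jof : Finset ι × ι → ι)
    (hUg : ∀ u ∈ Ug, Jof u ∈ Js ∧ u.2 ∈ 𝒳 (Jof u) ∧ u.2 ∈ u.1 ∧ Jof u ∈ u.1 ∧
      ∀ K ∈ u.1, K ≠ u.2 → K ≠ Jof u → (K ∈ Pool ∨ (fl (Jof u) u.2 ∧ K = I₀)))
    (hUc : ∀ u ∈ Uc, u.2 ∈ Hc ∧ u.2 ∈ u.1 ∧ I₀ ∈ u.1 ∧ ∀ K ∈ u.1, K ≠ u.2 → K ≠ I₀ → K ∈ Pool)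
    (hUh : ∀ u ∈ Uh, u.2 ∈ Hh ∧ u.2 ∈ u.1 ∧ (I₀ ∈ u.1 ∨ Dh u.2 ∈ u.1) ∧
      ∀ K ∈ u.1, K ≠ u.2 → K ≠ I₀ → K ≠ Dh u.2 → K ∈ Pool) :
    ∑ u ∈ Ug, ((∏ k ∈ u.1, θ k) * ∏ k ∈ univ \ u.1, (1 - θ k)) +
      ∑ u ∈ Uc, ((∏ k ∈ u.1, θ k) * ∏ k ∈ univ \ u.1, (1 - θ k)) +
      ∑ u ∈ Uh, ((∏ k ∈ u.1, θ k) * ∏ k ∈ univ \ u.1, (1 - θ k)) ≤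
      ∏ k ∈ univ \ Pool, (1 - θ k) +
        (∑ J ∈ Js, ∑ X ∈ 𝒳 J, wself J X + ∑ J ∈ Js, ∑ X ∈ 𝒳 J, ∑ Y ∈ 𝒳 J with (Y ≠ X ∧ ¬ M J X Y), wcross J X Y +
          ∑ X ∈ Hc ∪ Hh, wselfI X + ∑ X ∈ Hc ∪ Hh, ∑ Y ∈ Hc ∪ Hh with X < Y, wcrossI X Y) := by
  classical
  -- odds, pool credit, odds product
  set t : ι → ℝ := fun V => θ V / (1 - θ V) with ht
  set E₀ := ∏ k ∈ univ \ Pool, (1 - θ k) with hE₀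
  set P := ∏ k ∈ univ \ Pool, (1 + t k) with hP
  set W : Finset ι → ℝ := fun S => (∏ k ∈ S, θ k) * ∏ k ∈ univ \ S, (1 - θ k) with hW
  have ht0 : ∀ V, 0 ≤ t V := fun V => div_nonneg (hθ0 V) (by linarith [hθ1 V])
  have htmono : ∀ V V', θ V ≤ θ V' → t V ≤ t V' := by
    intro V V' h
    simp only [ht]
    rw [div_le_div_iff₀ (by linarith [hθ1 V]) (by linarith [hθ1 V'])]
    nlinarith [hθ0 V, hθ1 V']
  have hE₀pos : 0 < E₀ := prod_pos fun k _ => by linarith [hθ1 k]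
  have hPE : P * E₀ = 1 := prod_one_add_odds_mul_eq_one θ Pool hθ1
  have hP1 : 1 ≤ P := by
    have := one_add_sum_le_odds_prod t ht0 Pool ∅ (disjoint_empty_left _)
    simpa using this
  have hE₀1 : E₀ ≤ 1 := by nlinarith
  have hPinv : P = 1 / E₀ := by field_simp; linarith
  set T := t I₀ with hT
  have hT0 : 0 ≤ T := ht0 I₀
  have hW0 : ∀ S, 0 ≤ W S := fun S =>
    mul_nonneg (prod_nonneg fun k _ => hθ0 k) (prod_nonneg fun k _ => sub_nonneg.2 (hθ1 k).le)
  ------------------------------------------------------------------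
  -- STEP 1: demands of the entries (cylinder sums; file …StarSetPoolDemand)
  ------------------------------------------------------------------
  set demg : ι → ι → ℝ := fun J X => E₀ * (t X * t J * (1 + if fl J X then T else 0)) with hdemg
  have hUg_le : ∑ u ∈ Ug, W u.1 ≤ ∑ J ∈ Js, ∑ X ∈ 𝒳 J, demg J X := by
    have h := pool_demand_groups' θ hθ0 hθ1 Pool I₀ hI₀ Js hJs fl 𝒳 h𝒳 Ug Jof hUg
    simpa only [hW, hdemg, ht, hE₀, hT] using h
  have hUc_le : ∑ u ∈ Uc, W u.1 ≤ ∑ X ∈ Hc, E₀ * (T * t X) := by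
    have h := pool_demand_cold θ hθ0 hθ1 Pool I₀ hI₀ Hc hHc Uc hUc
    simpa only [hW, ht, hE₀, hT] using h
  have hUh_le : ∑ u ∈ Uh, W u.1 ≤ ∑ X ∈ Hh, E₀ * (t X * (T + t (Dh X) + T * t (Dh X))) := by
    have h := pool_demand_hot θ hθ0 hθ1 Pool I₀ hI₀ Hh hHh Dh hDh Uh hUh
    simpa only [hW, ht, hE₀, hT] using h

  ------------------------------------------------------------------
  -- STEP 2: needs of the entries
  ------------------------------------------------------------------
  have hEP' : E₀ * (P - 1) = 1 - E₀ := by linear_combination hPE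
  have hEP1 : E₀ * P = 1 := by rw [mul_comm]; exact hPE
  -- (2g) groups
  set σg : ι → ι → ℝ := fun J X => ∑ Y ∈ 𝒳 J with (Y ≠ X ∧ ¬ M J X Y), t Y with hσg
  set wordsg : ι → ι → ℝ := fun J X => wself J X + ∑ Y ∈ 𝒳 J with (Y ≠ X ∧ ¬ M J X Y), wcross J X Y with hwordsg
  have hneedg : ∀ J ∈ Js, ∀ X ∈ 𝒳 J,
      max 0 (demg J X - wordsg J X) ≤ E₀ * (t J * (t X * max 0 (1 - (P - 1) * (t X + σg J X)))) := by
    intro J hJ X hX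
    have hσ0 : 0 ≤ σg J X := sum_nonneg fun Y _ => ht0 Y
    have hwc : t X * σg J X * t J ≤ ∑ Y ∈ 𝒳 J with (Y ≠ X ∧ ¬ M J X Y), wcross J X Y := by
      have : t X * σg J X * t J = ∑ Y ∈ 𝒳 J with (Y ≠ X ∧ ¬ M J X Y), t X * t Y * t J := by
        simp only [hσg]; rw [mul_sum, sum_mul]
      rw [this]
      refine sum_le_sum fun Y hY => ?_
      obtain ⟨hY1, hY2⟩ := mem_filter.1 hY
      have := hwcross J hJ X hX Y hY1 hY2.1 hY2.2
      simpa only [ht] using this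
    have hws : (1 - E₀) * (t X * t X * t J) + E₀ * (t X * t J * (if fl J X then T else 0)) ≤ wself J X := by
      have hw := hwself J hJ X hX
      have hac : t X ≤ t (Dg J X) := htmono _ _ (hDg J hJ X hX)
      have a0 := ht0 X
      have b0 := ht0 J
      have hTX : 0 ≤ t X * t J := mul_nonneg a0 b0
      have hE₀0 := hE₀pos.le
      have h1E : 0 ≤ 1 - E₀ := sub_nonneg.2 hE₀1
      -- `(1 − E₀) t_X² t_J ≤ t_X t_J t_D`
      have hsq : (1 - E₀) * (t X * t X * t J) ≤ t X * t J * t (Dg J X) := by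
        have h := mul_le_mul_of_nonneg_left hac hTX
        have h0 : 0 ≤ E₀ * (t X * t X * t J) := mul_nonneg hE₀0 (mul_nonneg (mul_nonneg a0 a0) b0)
        nlinarith
      by_cases hf : fl J X
      · by_cases hD : Dg J X = I₀
        · rw [if_pos hf]
          rw [hD, if_neg (fun h => h.2 rfl)] at hw
          have hw' : t X * t J * T + 0 ≤ wself J X := by simpa only [ht, hT] using hw
          rw [hD, ← hT] at hac
          -- `T ≥ t_X`: split `t_X t_J T = (1−E₀) t_X t_J T + E₀ t_X t_J T`
          have h := mul_le_mul_of_nonneg_left hac hTX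
          have h3 : (1 - E₀) * (t X * t J * t X) ≤ (1 - E₀) * (t X * t J * T) := mul_le_mul_of_nonneg_left h h1E
          nlinarith
        · rw [if_pos hf]
          rw [if_pos ⟨hf, hD⟩] at hw
          have hw' : t X * t J * t (Dg J X) + t X * t J * T ≤ wself J X := by simpa only [ht, hT] using hw
          have h4 : E₀ * (t X * t J * T) ≤ t X * t J * T := by
            have : 0 ≤ (1 - E₀) * (t X * t J * T) := mul_nonneg h1E (mul_nonneg hTX hT0)
            nlinarith
          linarith
      · rw [if_neg hf]
        rw [if_neg (fun h => hf h.1)] at hw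
        have hw' : t X * t J * t (Dg J X) + 0 ≤ wself J X := by simpa only [ht, hT] using hw
        have : E₀ * (t X * t J * 0) = 0 := by ring
        linarith
    have key := pool_need_group E₀ P (t X) (t J) (σg J X) (if fl J X then T else 0) (wself J X)
      (∑ Y ∈ 𝒳 J with (Y ≠ X ∧ ¬ M J X Y), wcross J X Y) hE₀pos.le hEP' (ht0 X) (ht0 J) hσ0 hws hwc
    rw [show E₀ * (t J * (t X * max 0 (1 - (P - 1) * (t X + σg J X)))) =
        (E₀ * (t J * t X)) * max 0 (1 - (P - 1) * (t X + σg J X)) from by ring]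
    refine max_zero_le_mul_max_zero _ _ _ (mul_nonneg hE₀pos.le (mul_nonneg (ht0 J) (ht0 X))) ?_
    rw [show E₀ * (t J * t X) * (1 - (P - 1) * (t X + σg J X)) = E₀ * (t J * (t X * (1 - (P - 1) * (t X + σg J X)))) from
      by ring]
    simpa only [hdemg, hwordsg] using key
  -- (2I) the I₀-group
  set H := Hc ∪ Hh with hH
  set s' := ∑ X ∈ H, t X with hs'
  set wcI : ι → ι → ℝ := fun X Y => if X < Y then wcrossI X Y else wcrossI Y X with hwcI
  set wordsI : ι → ℝ := fun X => wselfI X + (∑ Y ∈ H with Y ≠ X, wcI X Y) / 2 with hwordsI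
  have hwcI_ge : ∀ X ∈ H, T * t X * (s' - t X) ≤ 2 * ((∑ Y ∈ H with Y ≠ X, wcI X Y) / 2) := by
    intro X hX
    have hsub : ∑ Y ∈ H with Y ≠ X, t Y = s' - t X := by
      rw [filter_ne', sum_erase_eq_sub hX]
    rw [← hsub, mul_sum]
    have : 2 * ((∑ Y ∈ H with Y ≠ X, wcI X Y) / 2) = ∑ Y ∈ H with Y ≠ X, wcI X Y := by ring
    rw [this]
    refine sum_le_sum fun Y hY => ?_
    obtain ⟨hYH, hYX⟩ := mem_filter.1 hY
    simp only [hwcI]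
    split_ifs with hlt
    · simpa only [ht, hT] using hwcrossI X hX Y hYH hlt
    · have hlt' : Y < X := lt_of_le_of_ne (not_lt.1 hlt) hYX
      have := hwcrossI Y hYH X hX hlt'
      have h' : T * t X * t Y = θ I₀ / (1 - θ I₀) * (θ Y / (1 - θ Y)) * (θ X / (1 - θ X)) := by
        simp only [ht, hT]; ring
      rw [h']; exact this
  have hneedc : ∀ X ∈ Hc, max 0 (E₀ * (T * t X) - wordsI X) ≤ E₀ * (T * (t X * max 0 (1 - P * t X - P * (s' - t X) / 2))) := by
    intro X hX
    have hXH : X ∈ H := mem_union_left _ hX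
    have hws : T * t X * t X ≤ wselfI X := by simpa only [ht, hT] using hwselfIc X hX
    have key := pool_need_cold E₀ P (t X) T s' (wselfI X) ((∑ Y ∈ H with Y ≠ X, wcI X Y) / 2) hEP1 hws (hwcI_ge X hXH)
    rw [show E₀ * (T * (t X * max 0 (1 - P * t X - P * (s' - t X) / 2))) =
        (E₀ * (T * t X)) * max 0 (1 - P * t X - P * (s' - t X) / 2) from by ring]
    refine max_zero_le_mul_max_zero _ _ _ (mul_nonneg hE₀pos.le (mul_nonneg hT0 (ht0 X))) ?_
    rw [show E₀ * (T * t X) * (1 - P * t X - P * (s' - t X) / 2) = E₀ * (T * (t X * (1 - P * t X - P * (s' - t X) / 2))) from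
      by ring]
    simpa only [hwordsI] using key
  have hneedh : ∀ X ∈ Hh, max 0 (E₀ * (t X * (T + t (Dh X) + T * t (Dh X))) - wordsI X) ≤
      E₀ * (t X * max 0 (T + t (Dh X) + T * t (Dh X) - P * T * t (Dh X) - P * T * (s' - t X) / 2)) := by
    intro X hX
    have hXH : X ∈ H := mem_union_right _ hX
    have hws : T * t X * t (Dh X) ≤ wselfI X := by simpa only [ht, hT] using hwselfIh X hX
    have key := pool_need_hot E₀ P (t X) (t (Dh X)) T s' (wselfI X) ((∑ Y ∈ H with Y ≠ X, wcI X Y) / 2) hEP1 hws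
      (hwcI_ge X hXH)
    rw [show E₀ * (t X * max 0 (T + t (Dh X) + T * t (Dh X) - P * T * t (Dh X) - P * T * (s' - t X) / 2)) =
        (E₀ * t X) * max 0 (T + t (Dh X) + T * t (Dh X) - P * T * t (Dh X) - P * T * (s' - t X) / 2) from by ring]
    refine max_zero_le_mul_max_zero _ _ _ (mul_nonneg hE₀pos.le (ht0 X)) ?_
    rw [show E₀ * t X * (T + t (Dh X) + T * t (Dh X) - P * T * t (Dh X) - P * T * (s' - t X) / 2) =
        E₀ * (t X * (T + t (Dh X) + T * t (Dh X) - P * T * t (Dh X) - P * T * (s' - t X) / 2)) from by ring]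
    simpa only [hwordsI] using key
  ------------------------------------------------------------------
  -- STEP 3: (P∅) and assembly
  ------------------------------------------------------------------
  have hscaled := pool_scaled_total_le_one Hc Hh (Hh.image Dh) Dh (fun X hX => mem_image_of_mem Dh hX) t t T P s' hT0
    (fun X _ => ht0 X) (fun X _ => ht0 X) (fun X hX => htmono _ _ (hDh X hX).2.2.2.2.2)
    (fun X hX => htmono _ _ (hDh X hX).2.2.2.2.1) (fun δ _ => ht0 δ) hfib
    (by
      -- `(1+T) Π_{Hh}(1+t) Π_{G}(1+t) ≤ P`
      have hIH : I₀ ∉ Hh ∪ Hh.image Dh := by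
        intro h
        rcases mem_union.1 h with h | h
        · exact (hHh I₀ h).2 rfl
        · obtain ⟨X, hX, hXe⟩ := mem_image.1 h
          exact (hDh X hX).2.1 hXe
      have hHG : Disjoint Hh (Hh.image Dh) := by
        rw [disjoint_right]
        intro δ hδ hδH
        obtain ⟨X, hX, rfl⟩ := mem_image.1 hδ
        exact (hDh X hX).2.2.1 hδH
      have hA : Disjoint (insert I₀ (Hh ∪ Hh.image Dh)) Pool := by
        rw [disjoint_left]
        intro k hk hkP
        rcases mem_insert.1 hk with rfl | hk
        · exact hI₀ hkP
        rcases mem_union.1 hk with hk | hk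
        · exact (hHh k hk).1 hkP
        · obtain ⟨X, hX, rfl⟩ := mem_image.1 hk
          exact (hDh X hX).1 hkP
      have hle := subprod_le_odds_prod t ht0 Pool (insert I₀ (Hh ∪ Hh.image Dh)) hA
      rw [prod_insert hIH, prod_union hHG] at hle
      simpa only [hP, hT] using hle)
    (sum_le_sum_of_subset_of_nonneg subset_union_left fun X _ _ => ht0 X)
    (sum_le_sum_of_subset_of_nonneg subset_union_right fun X _ _ => ht0 X)
    Js 𝒳 t (fun J _ => ht0 J) (fun _ => t) (fun J _ X _ => ht0 X) M hMsymm hMuniq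
    (by
      have hIJ : I₀ ∉ Js := fun h => (hJs I₀ h).2 rfl
      have hA : Disjoint (insert I₀ Js) Pool := by
        rw [disjoint_left]
        intro k hk hkP
        rcases mem_insert.1 hk with rfl | hk
        · exact hI₀ hkP
        · exact (hJs k hk).1 hkP
      have hle := one_add_sum_le_odds_prod t ht0 Pool (insert I₀ Js) hA
      rw [sum_insert hIJ] at hle
      simpa only [hP, hT, add_assoc] using hle)
  -- words
  have hwords_g : ∑ J ∈ Js, ∑ X ∈ 𝒳 J, wordsg J X =
      ∑ J ∈ Js, ∑ X ∈ 𝒳 J, wself J X + ∑ J ∈ Js, ∑ X ∈ 𝒳 J, ∑ Y ∈ 𝒳 J with (Y ≠ X ∧ ¬ M J X Y), wcross J X Y := by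
    simp only [hwordsg, sum_add_distrib]
  have hwords_I : ∑ X ∈ H, wordsI X = ∑ X ∈ H, wselfI X + ∑ X ∈ H, ∑ Y ∈ H with X < Y, wcrossI X Y := by
    simp only [hwordsI, sum_add_distrib]
    congr 1
    rw [← sum_div, sum_offDiag_symm H wcI (fun X _ Y _ => by
      simp only [hwcI]
      rcases lt_trichotomy X Y with h | h | h
      · rw [if_pos h, if_neg (lt_asymm h)]
      · subst h; rfl
      · rw [if_neg (lt_asymm h), if_pos h])]
    rw [mul_div_cancel_left₀ _ (two_ne_zero)]
    refine sum_congr rfl fun X _ => sum_congr rfl fun Y hY => ?_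
    simp only [hwcI, if_pos (mem_filter.1 hY).2]
  -- demands ≤ words + needs
  have hdw : ∀ a w : ℝ, a ≤ w + max 0 (a - w) := fun a w => by
    have := le_max_right 0 (a - w); linarith
  have htot_g : ∑ J ∈ Js, ∑ X ∈ 𝒳 J, demg J X ≤ ∑ J ∈ Js, ∑ X ∈ 𝒳 J, wordsg J X +
      E₀ * ∑ J ∈ Js, t J * ∑ X ∈ 𝒳 J, t X * max 0 (1 - (P - 1) * (t X + σg J X)) := by
    rw [mul_sum, ← sum_add_distrib]
    refine sum_le_sum fun J hJ => ?_
    rw [mul_sum, mul_sum, ← sum_add_distrib]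
    refine sum_le_sum fun X hX => ?_
    have h1 := hdw (demg J X) (wordsg J X)
    have h2 := hneedg J hJ X hX
    linarith
  have htot_c : ∑ X ∈ Hc, E₀ * (T * t X) ≤ ∑ X ∈ Hc, wordsI X +
      E₀ * (T * ∑ X ∈ Hc, t X * max 0 (1 - P * t X - P * (s' - t X) / 2)) := by
    rw [mul_sum, mul_sum, ← sum_add_distrib]
    refine sum_le_sum fun X hX => ?_
    have h1 := hdw (E₀ * (T * t X)) (wordsI X)
    have h2 := hneedc X hX
    linarith
  have htot_h : ∑ X ∈ Hh, E₀ * (t X * (T + t (Dh X) + T * t (Dh X))) ≤ ∑ X ∈ Hh, wordsI X +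
      E₀ * ∑ X ∈ Hh, t X * max 0 (T + t (Dh X) + T * t (Dh X) - P * T * t (Dh X) - P * T * (s' - t X) / 2) := by
    rw [mul_sum, ← sum_add_distrib]
    refine sum_le_sum fun X hX => ?_
    have h1 := hdw (E₀ * (t X * (T + t (Dh X) + T * t (Dh X)))) (wordsI X)
    have h2 := hneedh X hX
    linarith
  have hHsplit : ∑ X ∈ H, wordsI X = ∑ X ∈ Hc, wordsI X + ∑ X ∈ Hh, wordsI X := by
    rw [hH, sum_union hHcHh]
  -- final
  have hfinal : ∑ u ∈ Ug, W u.1 + ∑ u ∈ Uc, W u.1 + ∑ u ∈ Uh, W u.1 ≤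
      E₀ + (∑ J ∈ Js, ∑ X ∈ 𝒳 J, wordsg J X + ∑ X ∈ H, wordsI X) := by
    have hE₀scaled := mul_le_mul_of_nonneg_left hscaled hE₀pos.le
    rw [mul_one, mul_add, mul_add] at hE₀scaled
    linarith [hUg_le, hUc_le, hUh_le, htot_g, htot_c, htot_h, hHsplit, hE₀scaled]
  rw [hwords_g, hwords_I] at hfinal
  simpa only [hW, hH, add_assoc] using hfinal

end StarSet

end Summit.CriticalPhenomena.PercolationContinuityZ3.Theorems
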